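import Mathlib
import HarnessLib

/-!
# Extension by zero of functions flat at the boundary of a convex open set

Topic `Literature/Analysis/Calculus`. The calculus lemma behind "the solution can be smoothly
extended by zero across `∂M`" (P. T. Chruściel, E. Delay, *On mapping properties of the general
relativistic constraints operator in weighted function spaces*, Mém. SMF 94 (2003), **Cor. 5.11**:
solutions in the exponentially weighted spaces `x²C^∞_{x²,e^{s/x}}(M̄)` have all derivatives
tending to zero at `∂M`, hence extend by zero), which is the extension step (iii) of the assembly
of the named fact `Literature.Geometry.Lorentzian.ChruscielDelay_localConstraintDeformation`
(file `Literature/Geometry/Lorentzian/LocalConstraintDeformation.lean`; there `M̄ = B̄` is a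
closed coordinate ball). Everything here is PROVED; no definitions, no named facts.

**Theorem** (`contDiff_of_flat_frontier`). Let `U` be a convex open subset of a real normed
space `E`, `f : E → F` a map which is `Cⁿ` on `U` (`n ≤ ∞`), vanishes off `U`, and is *flat at
the boundary*: for every `m ≤ n` and every `p ∈ ∂U`, `Dᵐf(x) → 0` as `x → p`, `x ∈ U`. Then `f`
is `Cⁿ` on all of `E`. (`contDiff_of_flat_sphere`: the case of a ball, flatness at the sphere.)

Proof. The candidate Taylor series is the Taylor series of `f` within `U` extended by zero,
`q := 𝟙_U · ftaylorSeriesWithin ℝ f U`; we check `HasFTaylorSeriesUpToOn n f q univ` directly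
(no induction on `n`, so no universe bookkeeping): each term `q(·, m)` is continuous
(`continuous_indicator_ftaylorSeriesWithin`: on `U` it is the within-series, off `closure U` it
vanishes near the point, at `∂U` it tends to `0` from inside by flatness and is `0` outside), and
has derivative `q(x, m+1)` (curried) at every `x` (`hasFDerivAt_indicator_ftaylorSeriesWithin`):
inside and outside as before, and at `p ∈ ∂U` the derivative is `0` — within `closure U` by
Mathlib's one-derivative boundary lemma for CONVEX open sets
`hasFDerivWithinAt_closure_of_tendsto_fderiv` (the derivative on `U` is `q(·, m+1) → 0`), within
`Uᶜ` trivially, and `closure U ∪ Uᶜ = E`. Convexity enters only through that Mathlib lemma (for a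
general open set one argues along the last boundary crossing of a segment; not needed here).

## References

* P. T. Chruściel, E. Delay, Mém. Soc. Math. Fr. 94 (2003), Cor. 5.11. [ChruscielDelay2003]
* J. Dieudonné, *Foundations of Modern Analysis* (1960), (8.6.3)–(8.6.4) (limits of
  derivatives at the boundary), the one-derivative step. [folklore]
-/

noncomputable section

open Set Filter Metric Function
open scoped Topology ContDiff

namespace Literature.Analysis.Calculus

variable {E : Type*} [NormedAddCommGroup E] [NormedSpace ℝ E]
  {F : Type*} [NormedAddCommGroup F] [NormedSpace ℝ F]
  {U : Set E} {f : E → F} {n : ℕ∞}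

/-! ## The zero-extended Taylor series `𝟙_U · ftaylorSeriesWithin ℝ f U` -/

/-- On `U` (open) the `m`-th term of the zero-extended within-Taylor series of `f` is `Dᵐ f`.
[folklore] -/
theorem indicator_ftaylorSeriesWithin_apply_of_mem (hUo : IsOpen U) {x : E} (hx : x ∈ U)
    (m : ℕ) : U.indicator (ftaylorSeriesWithin ℝ f U) x m = iteratedFDeriv ℝ m f x := by
  rw [indicator_of_mem hx]
  exact iteratedFDerivWithin_of_isOpen m hUo hx

/-- Off `U` the zero-extended within-Taylor series of `f` vanishes. [folklore] -/
theorem indicator_ftaylorSeriesWithin_apply_of_notMem {x : E} (hx : x ∉ U) (m : ℕ) :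
    U.indicator (ftaylorSeriesWithin ℝ f U) x m = 0 := by
  rw [indicator_of_notMem hx]
  rfl

/-- **Continuity of the terms.** If `f` is `Cⁿ` on the open set `U` and `Dᵐ f → 0` at every
boundary point from inside (`m ≤ n`), then the `m`-th term of the zero-extended within-Taylor
series is continuous on `E`: near a point of `U` it is the within-series (continuous since `f` is
`Cⁿ` on `U`), near a point off `closure U` it is `0`, and at a boundary point it tends to its
value `0` both from inside (flatness) and from outside (where it is `0`). [folklore] -/
theorem continuous_indicator_ftaylorSeriesWithin (hUo : IsOpen U) (hf : ContDiffOn ℝ n f U)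
    {m : ℕ} (hm : (m : ℕ∞) ≤ n)
    (hflat : ∀ p ∈ frontier U, Tendsto (fun x ↦ iteratedFDeriv ℝ m f x) (𝓝[U] p) (𝓝 0)) :
    Continuous fun x ↦ U.indicator (ftaylorSeriesWithin ℝ f U) x m := by
  have H := hf.ftaylorSeriesWithin hUo.uniqueDiffOn
  refine continuous_iff_continuousAt.2 fun x ↦ ?_
  by_cases hxU : x ∈ U
  · -- near `x ∈ U` the function is the within-series term
    have hc : ContinuousOn (fun y ↦ ftaylorSeriesWithin ℝ f U y m) U := H.cont m (mod_cast hm)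
    have h1 : ContinuousAt (fun y ↦ ftaylorSeriesWithin ℝ f U y m) x :=
      hc.continuousAt (hUo.mem_nhds hxU)
    have heq : (fun y ↦ U.indicator (ftaylorSeriesWithin ℝ f U) y m) =ᶠ[𝓝 x]
        fun y ↦ ftaylorSeriesWithin ℝ f U y m := by
      filter_upwards [hUo.mem_nhds hxU] with y hy
      rw [indicator_of_mem hy]
    exact (continuousAt_congr heq).2 h1
  · have hx0 : U.indicator (ftaylorSeriesWithin ℝ f U) x m = 0 :=
      indicator_ftaylorSeriesWithin_apply_of_notMem hxU m
    by_cases hxc : x ∈ closure U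
    · -- boundary point: limit `0` from inside (flatness) and from outside (value `0`)
      have hxf : x ∈ frontier U := ⟨hxc, by rwa [hUo.interior_eq]⟩
      rw [ContinuousAt, hx0, ← nhdsWithin_univ, ← union_compl_self U, nhdsWithin_union]
      refine Tendsto.sup ?_ ?_
      · refine (hflat x hxf).congr' ?_
        filter_upwards [self_mem_nhdsWithin] with y hy
        exact (indicator_ftaylorSeriesWithin_apply_of_mem hUo hy m).symm
      · refine tendsto_const_nhds.congr' ?_
        filter_upwards [self_mem_nhdsWithin] with y hy
        exact (indicator_ftaylorSeriesWithin_apply_of_notMem hy m).symm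
    · -- off `closure U` the function vanishes near `x`
      have hW : (closure U)ᶜ ∈ 𝓝 x := isClosed_closure.isOpen_compl.mem_nhds hxc
      have heq : (fun y ↦ U.indicator (ftaylorSeriesWithin ℝ f U) y m) =ᶠ[𝓝 x]
          fun _ ↦ (0 : E[×m]→L[ℝ] F) := by
        filter_upwards [hW] with y hy
        exact indicator_ftaylorSeriesWithin_apply_of_notMem (fun h ↦ hy (subset_closure h)) m
      exact heq.continuousAt

/-- Currying on the left of the zero multilinear map is zero. [folklore] -/
theorem curryLeft_zero (m : ℕ) : (0 : E[×(m + 1)]→L[ℝ] F).curryLeft = 0 := by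
  ext v w
  simp

/-- **Differentiability of the terms, everywhere.** Let `U` be CONVEX and open, `f` of class
`Cⁿ` on `U`, `m < n`, with `Dᵐ f → 0` and `Dᵐ⁺¹ f → 0` at every boundary point from inside.
Then the `m`-th term of the zero-extended within-Taylor series has derivative its `(m+1)`-st
term (curried on the left) at EVERY point of `E`: inside `U` this is the within-Taylor series of
`f`; off `closure U` both vanish near the point; at a boundary point `p` the derivative is `0`,
within `closure U` by Mathlib's boundary lemma `hasFDerivWithinAt_closure_of_tendsto_fderiv`
(convex open sets; the derivative on `U` tends to `0` by flatness of order `m + 1`), within `Uᶜ`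
because the term vanishes there, and `closure U ∪ Uᶜ = E`. [folklore] -/
theorem hasFDerivAt_indicator_ftaylorSeriesWithin (hUo : IsOpen U) (hUc : Convex ℝ U)
    (hf : ContDiffOn ℝ n f U) {m : ℕ} (hm : (m : ℕ∞) < n)
    (hflat : ∀ p ∈ frontier U, Tendsto (fun x ↦ iteratedFDeriv ℝ m f x) (𝓝[U] p) (𝓝 0))
    (hflat' : ∀ p ∈ frontier U,
      Tendsto (fun x ↦ iteratedFDeriv ℝ (m + 1) f x) (𝓝[U] p) (𝓝 0))
    (x : E) :
    HasFDerivAt (fun y ↦ U.indicator (ftaylorSeriesWithin ℝ f U) y m)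
      (U.indicator (ftaylorSeriesWithin ℝ f U) x (m + 1)).curryLeft x := by
  have H := hf.ftaylorSeriesWithin hUo.uniqueDiffOn
  have hm' : (m : ℕ∞ω) < (n : ℕ∞ω) := mod_cast hm
  -- inside `U`: the within-Taylor series of `f`
  have hin : ∀ y ∈ U, HasFDerivAt (fun z ↦ U.indicator (ftaylorSeriesWithin ℝ f U) z m)
      (U.indicator (ftaylorSeriesWithin ℝ f U) y (m + 1)).curryLeft y := by
    intro y hy
    have h1 : HasFDerivAt (fun z ↦ ftaylorSeriesWithin ℝ f U z m)
        (ftaylorSeriesWithin ℝ f U y (m + 1)).curryLeft y :=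
      (H.fderivWithin m hm' y hy).hasFDerivAt (hUo.mem_nhds hy)
    rw [indicator_of_mem hy]
    refine h1.congr_of_eventuallyEq ?_
    filter_upwards [hUo.mem_nhds hy] with z hz
    rw [indicator_of_mem hz]
  by_cases hxU : x ∈ U
  · exact hin x hxU
  rw [indicator_ftaylorSeriesWithin_apply_of_notMem hxU (m + 1), curryLeft_zero]
  by_cases hxc : x ∈ closure U
  · -- boundary point
    have hcont : Continuous fun y ↦ U.indicator (ftaylorSeriesWithin ℝ f U) y m :=
      continuous_indicator_ftaylorSeriesWithin hUo hf hm.le hflat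
    have hxf : x ∈ frontier U := ⟨hxc, by rwa [hUo.interior_eq]⟩
    -- within `closure U`
    have hcl : HasFDerivWithinAt (fun y ↦ U.indicator (ftaylorSeriesWithin ℝ f U) y m)
        (0 : E →L[ℝ] E[×m]→L[ℝ] F) (closure U) x := by
      refine hasFDerivWithinAt_closure_of_tendsto_fderiv
        (fun y hy ↦ (hin y hy).differentiableAt.differentiableWithinAt) hUc hUo
        (fun y _ ↦ hcont.continuousAt.continuousWithinAt) ?_
      -- the derivative on `U` is the `(m+1)`-st term, which tends to `0`
      refine tendsto_zero_iff_norm_tendsto_zero.2 ?_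
      have h0 := tendsto_zero_iff_norm_tendsto_zero.1 (hflat' x hxf)
      refine h0.congr' ?_
      filter_upwards [self_mem_nhdsWithin] with y hy
      rw [(hin y hy).fderiv, ContinuousMultilinearMap.curryLeft_norm,
        indicator_ftaylorSeriesWithin_apply_of_mem hUo hy]
    -- within `Uᶜ`, where the term vanishes
    have hco : HasFDerivWithinAt (fun y ↦ U.indicator (ftaylorSeriesWithin ℝ f U) y m)
        (0 : E →L[ℝ] E[×m]→L[ℝ] F) Uᶜ x := by
      refine (hasFDerivWithinAt_const (0 : E[×m]→L[ℝ] F) x Uᶜ).congr_of_eventuallyEq ?_ ?_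
      · filter_upwards [self_mem_nhdsWithin] with y hy
        exact indicator_ftaylorSeriesWithin_apply_of_notMem hy m
      · exact indicator_ftaylorSeriesWithin_apply_of_notMem hxU m
    have hu : closure U ∪ Uᶜ = univ :=
      eq_univ_of_forall fun y ↦ (em (y ∈ U)).elim (fun h ↦ Or.inl (subset_closure h)) Or.inr
    have := hcl.union hco
    rw [hu] at this
    exact this.hasFDerivAt_of_univ
  · -- off `closure U`
    have hW : (closure U)ᶜ ∈ 𝓝 x := isClosed_closure.isOpen_compl.mem_nhds hxc
    refine (hasFDerivAt_const (0 : E[×m]→L[ℝ] F) x).congr_of_eventuallyEq ?_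
    filter_upwards [hW] with y hy
    exact indicator_ftaylorSeriesWithin_apply_of_notMem (fun h ↦ hy (subset_closure h)) m

/-! ## The extension theorem -/

/-- **Extension by zero of a function flat at the boundary of a convex open set.** Let `U` be
a convex open subset of a real normed space, `f` a map of class `Cⁿ` on `U` (`n ≤ ∞`) which
vanishes off `U` and all of whose derivatives of order `≤ n` tend to zero at the boundary from
inside: `Dᵐ f(x) → 0` as `x → p` within `U`, for every `m ≤ n` and `p ∈ ∂U`. Then `f` is `Cⁿ`
on the whole space (its Taylor series being the within-Taylor series on `U` extended by zero).
This is the mechanism of "the solution can be smoothly extended by zero across `∂M`" for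
solutions lying in exponentially weighted spaces all of whose derivatives decay at the
boundary (Chruściel–Delay, Mém. SMF 94 (2003), Cor. 5.11). [folklore] -/
theorem contDiff_of_flat_frontier (hUo : IsOpen U) (hUc : Convex ℝ U) (hf : ContDiffOn ℝ n f U)
    (hzero : ∀ x ∉ U, f x = 0)
    (hflat : ∀ m : ℕ, (m : ℕ∞) ≤ n → ∀ p ∈ frontier U,
      Tendsto (fun x ↦ iteratedFDeriv ℝ m f x) (𝓝[U] p) (𝓝 0)) :
    ContDiff ℝ n f := by
  have H := hf.ftaylorSeriesWithin hUo.uniqueDiffOn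
  suffices h : HasFTaylorSeriesUpToOn n f (U.indicator (ftaylorSeriesWithin ℝ f U)) univ from
    contDiffOn_univ.1 h.contDiffOn
  refine ⟨fun x _ ↦ ?_, fun m hm x _ ↦ ?_, fun m hm ↦ ?_⟩
  · by_cases hx : x ∈ U
    · rw [indicator_of_mem hx]
      exact H.zero_eq x hx
    · rw [indicator_of_notMem hx, hzero x hx]
      rfl
  · have hm' : (m : ℕ∞) < n := mod_cast hm
    have hm1 : ((m + 1 : ℕ) : ℕ∞) ≤ n := by
      have := Order.add_one_le_of_lt hm'
      exact_mod_cast this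
    exact (hasFDerivAt_indicator_ftaylorSeriesWithin hUo hUc hf hm' (hflat m hm'.le)
      (hflat (m + 1) hm1) x).hasFDerivWithinAt
  · have hm' : (m : ℕ∞) ≤ n := mod_cast hm
    exact (continuous_indicator_ftaylorSeriesWithin hUo hf hm' (hflat m hm')).continuousOn

/-- **Extension by zero across a sphere.** A map of class `Cⁿ` on an open ball `B(c, R)`,
`R > 0`, of a real normed space, vanishing off the ball, all of whose derivatives of order `≤ n`
tend to zero at the sphere `‖x − c‖ = R` from inside, is `Cⁿ` on the whole space — the case
`M̄ = B̄` (a closed coordinate ball) of "smooth extension by zero across `∂M`"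
(Chruściel–Delay, Mém. SMF 94 (2003), Cor. 5.11). [folklore] -/
theorem contDiff_of_flat_sphere {c : E} {R : ℝ} (hR : 0 < R) (hf : ContDiffOn ℝ n f (ball c R))
    (hzero : ∀ x, R ≤ dist x c → f x = 0)
    (hflat : ∀ m : ℕ, (m : ℕ∞) ≤ n → ∀ p, dist p c = R →
      Tendsto (fun x ↦ iteratedFDeriv ℝ m f x) (𝓝[ball c R] p) (𝓝 0)) :
    ContDiff ℝ n f := by
  refine contDiff_of_flat_frontier isOpen_ball (convex_ball c R) hf (fun x hx ↦ hzero x ?_)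
    fun m hm p hp ↦ hflat m hm p ?_
  · simpa [mem_ball] using hx
  · rw [frontier_ball c hR.ne', mem_sphere] at hp
    exact hp

end Literature.Analysis.Calculus

end
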